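import Summits.AtomisticToContinuum.HydrodynamicLimit.Theorems.JaynesSqueezeBlockGibbsToRelEntropyAssembly
import Summits.AtomisticToContinuum.HydrodynamicLimit.Theorems.JaynesSqueezeSqueezeToBlockGibbsPinning
import Summits.AtomisticToContinuum.HydrodynamicLimit.Theorems.TwoClocksClampedWindowDockTimeZero
import Literature.MathematicalPhysics.KineticTheory.HardSphereEulerLLN

/-!
# `BlockGibbsToRelEntropy` (stmt-AtomisticToContinuum-13464), VI: the item reduced to convergence of the mean empirical fields

Route JaynesSqueeze, support item `BlockGibbsToRelEntropy`. Parts I–V reduce the item to its KL core and prove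
the core at a time `t` from the statics of the Euler-driven reference and CONVERGENCE OF THE MEAN EMPIRICAL
FIELDS at time `t` (`klCore_at_of_meanFields`). This file discharges every static input from the item's own
antecedents, so that the item is reduced to the single dynamical statement "MeanFieldsConverge" (the planner's
foreseen middle layer `KineticClosure → MeanFieldsConverge → EulerReferenceBookkeeping` of the route's two-layer
plan; the last arrow is now proved):

* `klCore_of_meanFieldsConverge` — `HardSphereLDA`, `HsEosLowDensity`, `DiluteSelfConsistency` and
  MeanFieldsConverge give the KL core: the analytic band from `HsEosLowDensity`; the packing from
  `DiluteSelfConsistency`; `θ(0) = θ₀` by DATA PINNING (`EntropyClockDock.data_eq_of_ties` with the tree's law of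
  large numbers `localGibbs_lln_holds`); the representation `a₀ = e^c ρ₀ e^{g_σ(ρ₀)}` from `HardSphereLDA` (A), the
  mean-density limit of (B), activity scaling, bounded convergence in probability
  (`JaynesSqueezeSqueeze.tendsto_integral_of_tendsto_measure_gt`) and uniqueness of densities tested against
  continuous functions (`JaynesSqueezeSqueeze.ae_eq_of_forall_integral_mul_eq`); the two log-partition limits
  from (B) at `ρ₀` and `ρ_t`;
* `blockGibbsToRelEntropy_of_meanFieldsConverge` — hence MeanFieldsConverge ALONE implies the item
  (`blockGibbsToRelEntropy_of_klCore` of part I); the item's antecedents `BlockGibbs`, `CollisionalFluxLocality`,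
  `EnergyCurrentTails`, `MeanBlocksInRange`, `EntropicWeakStrongHS` are the inputs from which MeanFieldsConverge is
  to be produced (steps (a)–(c) of the item's plan).

No definitions (MeanFieldsConverge is written out as a hypothesis). prover-pitem-stmt-AtomisticToContinuum-13464-0.
-/

noncomputable section

namespace Summit.AtomisticToContinuum.HydrodynamicLimit.Theorems.JaynesSqueezeClosure

open MeasureTheory Filter Set Topology InformationTheory
open scoped ENNReal ContDiff
open Literature.MathematicalPhysics.KineticTheory Literature.Analysis.FluidPDE Literature.Analysis.FunctionSpaces
open MacroClosureLine.StubLedger JaynesSqueezeSqueeze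
open Summit.AtomisticToContinuum.HydrodynamicLimit.Theses.JaynesSqueeze

/-! ### §1 Small facts: positive lower bounds, the initial local Gibbs law -/

/-- A continuous positive function on `𝕋³` has a positive lower bound. [folklore] -/
theorem exists_pos_lower_bound {f : T3 → ℝ} (hf : Continuous f) (hf0 : ∀ x, 0 < f x) :
    ∃ c : ℝ, 0 < c ∧ ∀ x, c ≤ f x := by
  obtain ⟨x₀, -, hx₀⟩ := isCompact_univ.exists_isMinOn univ_nonempty hf.continuousOn
  exact ⟨f x₀, hf0 x₀, fun x => hx₀ (mem_univ x)⟩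

/-- At time `0` the flow is the identity almost surely under the local Gibbs law, so means of observables of
`Φ₀ z` are means of observables of `z`. [folklore] -/
theorem integral_comp_flow_zero {σ : ℝ} {a₀ θ₀ : T3 → ℝ} {u₀ : T3 → V3} (N : ℕ)
    (Φ : HardSphereFlow (Torus.geometry (Fin 3)) (hsDiameter σ N) (N + 1)) (F : Config (N + 1) (Fin 3) T3 → ℝ) :
    ∫ z, F (Φ.flow 0 z) ∂(localGibbsLaw σ a₀ u₀ θ₀ N Φ) = ∫ z, F z ∂(localGibbsLaw σ a₀ u₀ θ₀ N Φ) := by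
  have hac : localGibbsLaw σ a₀ u₀ θ₀ N Φ ≪ liouville (Torus.geometry (Fin 3)) (N + 1) (hsDiameter σ N) := by
    rw [localGibbsLaw, particleLaw_eq]; exact withDensity_absolutelyContinuous _ _
  refine integral_congr_ae ?_
  filter_upwards [hac.ae_le Φ.ae_mem_good] with z hz
  rw [Φ.flow_zero z hz]

/-- **Convergence of the mean empirical density at time zero from the tie.** Under the local Gibbs laws of
continuous positive profiles (`σ ≤ 1/2`), a field triple tied to them at `t = 0` has
`E_λ[ρ̂_z(χ)] → ∫ χ ρ(0)` for every continuous `χ` (bounded convergence in probability). [folklore] -/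
theorem tendsto_integral_empiricalDensityField_of_tie {σ : ℝ} (hσ2 : σ ≤ 1 / 2) {a₀ θ₀ : T3 → ℝ} {u₀ : T3 → V3}
    (ha : Continuous a₀) (hθ : Continuous θ₀) (hu : Continuous u₀) (ha0 : ∀ x, 0 < a₀ x) (hθ0 : ∀ x, 0 < θ₀ x)
    {ρ θ : ℝ → T3 → ℝ} {u : ℝ → T3 → V3}
    (Φ : (N : ℕ) → HardSphereFlow (Torus.geometry (Fin 3)) (hsDiameter σ N) (N + 1))
    (htie : TendstoHydroFieldsAt (fun N => localGibbsLaw σ a₀ u₀ θ₀ N (Φ N)) Φ ρ u θ 0)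
    {χ : T3 → ℝ} (hχ : Continuous χ) :
    Tendsto (fun N : ℕ => ∫ z, empiricalDensityField z χ ∂(localGibbsLaw σ a₀ u₀ θ₀ N (Φ N))) atTop
      (𝓝 (∫ x, χ x * ρ 0 x)) := by
  obtain ⟨C, hC0, hC⟩ := exists_forall_abs_le_of_continuous hχ
  have hP : ∀ᶠ N in atTop, IsProbabilityMeasure (localGibbsLaw σ a₀ u₀ θ₀ N (Φ N)) :=
    Eventually.of_forall fun N => isProbabilityMeasure_localGibbsLaw ha hθ hu ha0 hθ0 hσ2 N (Φ N)
  have hm : ∀ N : ℕ, Measurable fun z : Config (N + 1) (Fin 3) T3 => empiricalDensityField ((Φ N).flow 0 z) χ := by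
    intro N
    have h1 : Measurable fun z : Config (N + 1) (Fin 3) T3 => empiricalDensityField z χ := by
      simp_rw [empiricalDensityField_eq_sum]
      exact measurable_const.mul (Finset.measurable_sum _ fun i _ => hχ.measurable.comp (measurable_pi_apply i).fst)
    exact h1.comp ((Φ N).measurable_flow 0)
  -- the limit is bounded by `C` too (it is a limit of quantities bounded by `C`), but we only need SOME bound
  set M : ℝ := max C |∫ x, χ x * ρ 0 x| with hM
  have h := tendsto_integral_of_tendsto_measure_gt hP hm (M := M) (c := ∫ x, χ x * ρ 0 x)
    (fun N z => (abs_empiricalDensityField_le _ hC).trans (le_max_left _ _)) (le_max_right _ _)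
    (fun δ hδ => (htie χ hχ δ hδ).1)
  refine h.congr fun N => ?_
  exact integral_comp_flow_zero N (Φ N) fun z => empiricalDensityField z χ

/-! ### §2 The KL core from MeanFieldsConverge -/

/-- **The KL core of `BlockGibbsToRelEntropy` from convergence of the mean empirical fields.** Given the statics
`HardSphereLDA`, `HsEosLowDensity`, `DiluteSelfConsistency` of route JaynesSqueeze and the dynamical statement
MeanFieldsConverge — for continuous positive profiles, below some `σ₀`, along every classical hard-sphere-Euler
solution tied at `t = 0` to the local Gibbs laws through a flow family, at every `t ∈ [0, T)` the MEANS of the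
empirical density / momentum / energy fields of `Φ_t z` tested against every continuous `χ` converge to the Euler
fields — the specific relative entropy of the law at time `t` with respect to the Euler-driven reference
`(ρ_t e^{g_σ(ρ_t)}, u_t, θ_t)` vanishes (the hypothesis `core` of `blockGibbsToRelEntropy_of_klCore`).
[cite: Yau1991, §2] -/
theorem klCore_of_meanFieldsConverge
    (hMFC : ∀ (a₀ θ₀ : T3 → ℝ) (u₀ : T3 → V3), Continuous a₀ → Continuous θ₀ → Continuous u₀ →
      (∀ x, 0 < a₀ x) → (∀ x, 0 < θ₀ x) → ∃ σ₀ : ℝ, 0 < σ₀ ∧ ∀ σ : ℝ, 0 < σ → σ < σ₀ →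
      ∀ (T : ℝ) (ρ θ : ℝ → T3 → ℝ) (u : ℝ → T3 → V3), IsHardSphereEulerSolution σ T ρ u θ →
      ∀ Φ : (N : ℕ) → HardSphereFlow (Torus.geometry (Fin 3)) (hsDiameter σ N) (N + 1),
      TendstoHydroFieldsAt (fun N => localGibbsLaw σ a₀ u₀ θ₀ N (Φ N)) Φ ρ u θ 0 →
      ∀ t ∈ Set.Ico 0 T,
        (∀ χ : T3 → ℝ, Continuous χ → Tendsto (fun N : ℕ => ∫ z, empiricalDensityField ((Φ N).flow t z) χ
          ∂(localGibbsLaw σ a₀ u₀ θ₀ N (Φ N))) atTop (𝓝 (∫ x, χ x * ρ t x))) ∧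
        (∀ χ : T3 → ℝ, Continuous χ → ∀ j : Fin 3,
          Tendsto (fun N : ℕ => ∫ z, empiricalMomentumField ((Φ N).flow t z) χ j
            ∂(localGibbsLaw σ a₀ u₀ θ₀ N (Φ N))) atTop (𝓝 (∫ x, χ x * (ρ t x • u t x) j))) ∧
        (∀ χ : T3 → ℝ, Continuous χ → Tendsto (fun N : ℕ => ∫ z, empiricalEnergyField ((Φ N).flow t z) χ
          ∂(localGibbsLaw σ a₀ u₀ θ₀ N (Φ N))) atTop
            (𝓝 (∫ x, χ x * totalEnergyDensity (ρ t x) (u t x) (θ t x)))))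
    (h₇ : HardSphereLDA) (h₆ : HsEosLowDensity) (h₅ : DiluteSelfConsistency) :
    ∀ (a₀ θ₀ : T3 → ℝ) (u₀ : T3 → V3), Continuous a₀ → Continuous θ₀ → Continuous u₀ →
      (∀ x, 0 < a₀ x) → (∀ x, 0 < θ₀ x) → ∃ σ₀ : ℝ, 0 < σ₀ ∧ ∀ σ : ℝ, 0 < σ → σ < σ₀ →
      ∀ (T : ℝ) (ρ θ : ℝ → T3 → ℝ) (u : ℝ → T3 → V3), IsHardSphereEulerSolution σ T ρ u θ →
      ∀ Φ : (N : ℕ) → HardSphereFlow (Torus.geometry (Fin 3)) (hsDiameter σ N) (N + 1),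
      TendstoHydroFieldsAt (fun N => localGibbsLaw σ a₀ u₀ θ₀ N (Φ N)) Φ ρ u θ 0 →
      ∀ t ∈ Set.Ico 0 T,
        Tendsto (fun N : ℕ => klDiv ((Φ N).lawAt (localGibbsLaw σ a₀ u₀ θ₀ N (Φ N)) t)
          (localGibbsLaw σ (fun x => ρ t x * Real.exp (hsExcessFreeEnergy (ρ t x * σ ^ 3) +
            ρ t x * σ ^ 3 * deriv hsExcessFreeEnergy (ρ t x * σ ^ 3))) (u t) (θ t) N (Φ N)) /
          ((N : ℝ≥0∞) + 1)) atTop (𝓝 0) := by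
  intro a₀ θ₀ u₀ ha hθ hu ha0 hθ0
  -- the statics
  obtain ⟨η₁, hη₁, HL⟩ := h₇ h₆
  -- the analytic band
  obtain ⟨η₀, hη₀, F, hF, hEqOn, -, -, -⟩ := h₆
  have hfI : ContDiffOn ℝ ∞ hsExcessFreeEnergy (Ioo 0 η₀) :=
    (hF.contDiffOn_of_completeSpace.mono (Ioo_subset_Ioo_left (neg_nonpos.2 hη₀.le))).congr
      fun x hx => hEqOn (Ioo_subset_Ico_self hx)
  -- thresholds
  obtain ⟨σM, hσM, HM⟩ := hMFC a₀ θ₀ u₀ ha hθ hu ha0 hθ0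
  obtain ⟨σL, hσL, HLLN⟩ := localGibbs_lln_holds a₀ θ₀ u₀ ha hθ hu ha0 hθ0
  obtain ⟨σD, hσD, HD⟩ := h₅ (min η₀ η₁) (lt_min hη₀ hη₁) a₀ θ₀ u₀ ha hθ hu ha0 hθ0
  -- bounds of the initial activity: `Λ⁻¹ ≤ a₀ ≤ Λ`, `1 ≤ Λ`
  obtain ⟨m, hm0, hm⟩ := exists_pos_lower_bound ha ha0
  obtain ⟨Mx, -, hMx⟩ := exists_forall_abs_le_of_continuous ha
  set Λ : ℝ := max (max Mx m⁻¹) 1 with hΛ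
  have hΛ1 : 1 ≤ Λ := le_max_right _ _
  have hΛpos : 0 < Λ := one_pos.trans_le hΛ1
  have haΛ : ∀ x, Λ⁻¹ ≤ a₀ x ∧ a₀ x ≤ Λ := fun x =>
    ⟨(inv_le_comm₀ hΛpos (ha0 x)).2 ((inv_anti₀ hm0 (hm x)).trans ((le_max_right _ _).trans (le_max_left _ _))),
      ((le_abs_self _).trans (hMx x)).trans ((le_max_left _ _).trans (le_max_left _ _))⟩
  have hq : 0 < η₁ / (2 * Λ ^ 2) := by positivity
  refine ⟨min (min (1 / 4) (η₁ / (2 * Λ ^ 2))) (min σM (min σL σD)),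
    lt_min (lt_min (by norm_num) hq) (lt_min hσM (lt_min hσL hσD)), fun σ hσ hσlt T ρ θ u hE Φ htie t ht => ?_⟩
  have hσ4 : σ < 1 / 4 := hσlt.trans_le ((min_le_left _ _).trans (min_le_left _ _))
  have hσq : σ ≤ η₁ / (2 * Λ ^ 2) := (hσlt.trans_le ((min_le_left _ _).trans (min_le_right _ _))).le
  have hσM' : σ < σM := hσlt.trans_le ((min_le_right _ _).trans (min_le_left _ _))
  have hσL' : σ < σL := hσlt.trans_le ((min_le_right _ _).trans ((min_le_right _ _).trans (min_le_left _ _)))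
  have hσD' : σ < σD := hσlt.trans_le ((min_le_right _ _).trans ((min_le_right _ _).trans (min_le_right _ _)))
  have hσ2 : σ < 2⁻¹ := hσ4.trans (by norm_num)
  have hσ2' : σ ≤ 1 / 2 := by rw [one_div]; exact hσ2.le
  have h0 : (0 : ℝ) ∈ Ico 0 T := ⟨le_rfl, ht.1.trans_lt ht.2⟩
  -- `σ³ ≤ σ` and the two smallness conditions of the statics
  have hσ31 : σ ^ 3 ≤ σ := by
    have h1 : σ ≤ 1 := hσ4.le.trans (by norm_num)
    calc σ ^ 3 ≤ σ ^ 1 := pow_le_pow_of_le_one hσ.le h1 (by norm_num)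
      _ = σ := pow_one σ
  have hΛσ : Λ ^ 2 * σ ^ 3 ≤ η₁ := by
    have h2 : 0 < 2 * Λ ^ 2 := by positivity
    have : σ ^ 3 ≤ η₁ / (2 * Λ ^ 2) := hσ31.trans hσq
    have h3 : Λ ^ 2 * σ ^ 3 ≤ Λ ^ 2 * (η₁ / (2 * Λ ^ 2)) := mul_le_mul_of_nonneg_left this (sq_nonneg _)
    have h4 : Λ ^ 2 * (η₁ / (2 * Λ ^ 2)) = η₁ / 2 := by field_simp
    linarith [h3, h4, hη₁]
  have h2Λσ : 2 * Λ ^ 2 * σ ^ 3 ≤ η₁ := by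
    have : σ ^ 3 ≤ η₁ / (2 * Λ ^ 2) := hσ31.trans hσq
    have h3 := mul_le_mul_of_nonneg_left this (by positivity : (0 : ℝ) ≤ 2 * Λ ^ 2)
    rwa [mul_div_cancel₀ _ (by positivity : (2 : ℝ) * Λ ^ 2 ≠ 0)] at h3
  -- packing along the solution
  have hband : ∀ s ∈ Ico 0 T, ∀ x, ρ s x * σ ^ 3 < min η₀ η₁ := HD σ hσ hσD' T ρ θ u hE Φ htie
  have hband₀ : ∀ s ∈ Ico 0 T, ∀ x, ρ s x * σ ^ 3 < η₀ := fun s hs x => (hband s hs x).trans_le (min_le_left _ _)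
  -- data pinning: `(ρ, u, θ)(0)` are the LLN limits of the initial profiles
  obtain ⟨ρ₀', hρ₀'c, hρ₀'pos, Hlln⟩ := HLLN σ hσ hσL'
  obtain ⟨-, -, hθeq⟩ := EntropyClockDock.data_eq_of_ties hσ2' Φ ha hθ hu ha0 hθ0 hρ₀'c hρ₀'pos (Hlln Φ).2
    (hE.smooth_density.isSmooth_slice h0).continuous (hE.smooth_velocity.isSmooth_slice h0).continuous
    (hE.smooth_temperature.isSmooth_slice h0).continuous htie
  -- the Euler density at time `0`
  have hρ0c : Continuous (ρ 0) := (hE.smooth_density.isSmooth_slice h0).continuous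
  have hρ0pos : ∀ x, 0 < ρ 0 x := hE.density_pos 0 h0
  have hmass0 : ∫ x, ρ 0 x = 1 := DenseExcursionEverywhere.integral_density_zero_eq_one hσ2' ha hθ hu ha0 hθ0 Φ htie
  have hD0 : ∀ χ : T3 → ℝ, Continuous χ → Tendsto (fun N : ℕ => ∫ z, empiricalDensityField z χ
      ∂(localGibbsLaw σ a₀ u₀ θ₀ N (Φ N))) atTop (𝓝 (∫ x, χ x * ρ 0 x)) := fun χ hχ =>
    tendsto_integral_empiricalDensityField_of_tie hσ2' ha hθ hu ha0 hθ0 Φ htie hχ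
  -- HardSphereLDA (A): the initial activity through a normalised density `ρa`
  obtain ⟨ρa, hρam, hρab, hρa1, c, hac⟩ := (HL σ hσ).1 Λ hΛ1 hΛσ a₀ ha.measurable haΛ
  beta_reduce at hac
  -- HardSphereLDA (B) at `ρa`: the mean empirical density of the initial law tends to `ρa`
  have hca : 0 < (2 * Λ ^ 2)⁻¹ := by positivity
  have hρabounds : ∀ x, (2 * Λ ^ 2)⁻¹ ≤ ρa x ∧ ρa x * σ ^ 3 ≤ η₁ := fun x =>
    ⟨(hρab x).1, (mul_le_mul_of_nonneg_right (hρab x).2 (pow_nonneg hσ.le 3)).trans h2Λσ⟩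
  have HBa := (HL σ hσ).2 _ hca ρa hρam hρabounds hρa1 u₀ θ₀ hu.measurable hθ.measurable hθ0 Φ
  have hlawa : ∀ N : ℕ, localGibbsLaw σ a₀ u₀ θ₀ N (Φ N) =
      localGibbsLaw σ (fun x => ρa x * Real.exp (hsExcessFreeEnergy (ρa x * σ ^ 3) +
        ρa x * σ ^ 3 * deriv hsExcessFreeEnergy (ρa x * σ ^ 3))) u₀ θ₀ N (Φ N) := by
    intro N
    have hfun : a₀ = fun x => Real.exp c * (ρa x * Real.exp (hsExcessFreeEnergy (ρa x * σ ^ 3) +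
        ρa x * σ ^ 3 * deriv hsExcessFreeEnergy (ρa x * σ ^ 3))) := by
      funext x; rw [hac x]; ring
    rw [hfun]
    exact localGibbsLaw_const_mul (Φ N) _ _ _ (Real.exp_pos c)
  have hDa : ∀ χ : T3 → ℝ, Continuous χ → Tendsto (fun N : ℕ => ∫ z, empiricalDensityField z χ
      ∂(localGibbsLaw σ a₀ u₀ θ₀ N (Φ N))) atTop (𝓝 (∫ x, χ x * ρa x)) := by
    intro χ hχ
    have h := HBa.2.2 χ hχ
    refine h.congr fun N => ?_
    rw [hlawa N]
  -- hence `ρa = ρ 0` almost everywhere, and the activity representation everywhere (continuity)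
  have hρaint : Integrable ρa := by
    refine (integrable_const (2 * Λ ^ 2)).mono' hρam.aestronglyMeasurable (ae_of_all _ fun x => ?_)
    rw [Real.norm_eq_abs, abs_of_nonneg (hca.le.trans (hρab x).1)]
    exact (hρab x).2
  have hae : ρa =ᵐ[volume] ρ 0 :=
    ae_eq_of_forall_integral_mul_eq hρaint (integrable_of_continuous_T3 hρ0c) (fun x => hca.le.trans (hρab x).1)
      (fun x => (hρ0pos x).le) fun χ hχ => tendsto_nhds_unique (hDa χ hχ) (hD0 χ hχ)
  have harepr : ∀ x, a₀ x = Real.exp c * (ρ 0 x * Real.exp (hsExcessFreeEnergy (ρ 0 x * σ ^ 3) +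
      ρ 0 x * σ ^ 3 * deriv hsExcessFreeEnergy (ρ 0 x * σ ^ 3))) := by
    have hcont : Continuous fun x => Real.exp c * (ρ 0 x * Real.exp (hsExcessFreeEnergy (ρ 0 x * σ ^ 3) +
        ρ 0 x * σ ^ 3 * deriv hsExcessFreeEnergy (ρ 0 x * σ ^ 3))) :=
      continuous_const.mul (continuous_refActivity hσ hfI hρ0c hρ0pos (hband₀ 0 h0))
    have haeq : a₀ =ᵐ[volume] fun x => Real.exp c * (ρ 0 x * Real.exp (hsExcessFreeEnergy (ρ 0 x * σ ^ 3) +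
        ρ 0 x * σ ^ 3 * deriv hsExcessFreeEnergy (ρ 0 x * σ ^ 3))) := by
      filter_upwards [hae] with x hx
      rw [hac x, hx]; ring
    exact fun x => congrFun ((Continuous.ae_eq_iff_eq volume ha hcont).1 haeq) x
  -- HardSphereLDA (B) at `ρ 0` and at `ρ t`: the two log-partition limits
  obtain ⟨c₀, hc₀, hc₀le⟩ := exists_pos_lower_bound hρ0c hρ0pos
  have HB0 := (HL σ hσ).2 c₀ hc₀ (ρ 0) hρ0c.measurable
    (fun x => ⟨hc₀le x, ((hband 0 h0 x).le.trans (min_le_right _ _))⟩) hmass0 u₀ θ₀ hu.measurable hθ.measurable hθ0 Φ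
  have hρtc : Continuous (ρ t) := (hE.smooth_density.isSmooth_slice ht).continuous
  have hρtpos : ∀ x, 0 < ρ t x := hE.density_pos t ht
  have hmasst : ∫ x, ρ t x = 1 := by rw [DenseExcursionEverywhere.integral_density_eq hE ht, hmass0]
  obtain ⟨cₜ, hcₜ, hcₜle⟩ := exists_pos_lower_bound hρtc hρtpos
  have HBt := (HL σ hσ).2 cₜ hcₜ (ρ t) hρtc.measurable
    (fun x => ⟨hcₜle x, ((hband t ht x).le.trans (min_le_right _ _))⟩) hmasst (u t) (θ t)
    (hE.smooth_velocity.isSmooth_slice ht).continuous.measurable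
    (hE.smooth_temperature.isSmooth_slice ht).continuous.measurable (hE.temperature_pos t ht) Φ
  -- MeanFieldsConverge at time `t`
  obtain ⟨hDt, hMt, hEt⟩ := HM σ hσ hσM' T ρ θ u hE Φ htie t ht
  exact klCore_at_of_meanFields hσ hσ2 ha hθ hu ha0 hθ0 hfI hE hband₀ Φ htie hθeq harepr ht HB0.1 HBt.1 hD0 hDt hMt hEt

/-- **`BlockGibbsToRelEntropy` from MeanFieldsConverge.** The item follows from the single dynamical statement
MeanFieldsConverge (convergence of the mean empirical density / momentum / energy fields of `Φ_t z` to the Euler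
fields at every `t ∈ [0, T)`, below some `σ₀`, along every tied classical solution): the statics among the item's
antecedents feed `klCore_of_meanFieldsConverge`, and `blockGibbsToRelEntropy_of_klCore` (part I) does the rest.
What the remaining antecedents `BlockGibbs`, `CollisionalFluxLocality`, `EnergyCurrentTails`, `MeanBlocksInRange`,
`EntropicWeakStrongHS` must deliver is exactly MeanFieldsConverge. [cite: Yau1991, §2] -/
theorem blockGibbsToRelEntropy_of_meanFieldsConverge
    (hMFC : ∀ (a₀ θ₀ : T3 → ℝ) (u₀ : T3 → V3), Continuous a₀ → Continuous θ₀ → Continuous u₀ →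
      (∀ x, 0 < a₀ x) → (∀ x, 0 < θ₀ x) → ∃ σ₀ : ℝ, 0 < σ₀ ∧ ∀ σ : ℝ, 0 < σ → σ < σ₀ →
      ∀ (T : ℝ) (ρ θ : ℝ → T3 → ℝ) (u : ℝ → T3 → V3), IsHardSphereEulerSolution σ T ρ u θ →
      ∀ Φ : (N : ℕ) → HardSphereFlow (Torus.geometry (Fin 3)) (hsDiameter σ N) (N + 1),
      TendstoHydroFieldsAt (fun N => localGibbsLaw σ a₀ u₀ θ₀ N (Φ N)) Φ ρ u θ 0 →
      ∀ t ∈ Set.Ico 0 T,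
        (∀ χ : T3 → ℝ, Continuous χ → Tendsto (fun N : ℕ => ∫ z, empiricalDensityField ((Φ N).flow t z) χ
          ∂(localGibbsLaw σ a₀ u₀ θ₀ N (Φ N))) atTop (𝓝 (∫ x, χ x * ρ t x))) ∧
        (∀ χ : T3 → ℝ, Continuous χ → ∀ j : Fin 3,
          Tendsto (fun N : ℕ => ∫ z, empiricalMomentumField ((Φ N).flow t z) χ j
            ∂(localGibbsLaw σ a₀ u₀ θ₀ N (Φ N))) atTop (𝓝 (∫ x, χ x * (ρ t x • u t x) j))) ∧
        (∀ χ : T3 → ℝ, Continuous χ → Tendsto (fun N : ℕ => ∫ z, empiricalEnergyField ((Φ N).flow t z) χ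
          ∂(localGibbsLaw σ a₀ u₀ θ₀ N (Φ N))) atTop
            (𝓝 (∫ x, χ x * totalEnergyDensity (ρ t x) (u t x) (θ t x))))) :
    BlockGibbsToRelEntropy :=
  blockGibbsToRelEntropy_of_klCore fun _ _ _ _ _ h₇ _ h₆ h₅ => klCore_of_meanFieldsConverge hMFC h₇ h₆ h₅

end Summit.AtomisticToContinuum.HydrodynamicLimit.Theorems.JaynesSqueezeClosure

end
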